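import Mathlib
import Literature.MathematicalPhysics.QuantumFieldTheory.Dimock2011to13.LargeFieldRegionVolume
import Literature.MathematicalPhysics.QuantumFieldTheory.Dimock2011to13.CharacteristicFunctionSplit
import Literature.MathematicalPhysics.QuantumFieldTheory.Dimock2011to13.WalkExitExtraction

/-!
# Dimock, *The renormalization group according to Balaban* II (large fields), §3.1.5∕§3.5∕§3.10: the LAYER DISTANCE
# between LM-cubes of the periodic carrier `(ℤ/N′)^d`, and the bridge identifying `CharacteristicFunctionSplit`'s
# abstract `X^{n*}`∕`X^{n♮}` with the cell's sup-norm ball enlargement `RegionVolume.enl` — the §3.5∕§3.10 region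
# geometry ON THE TORUS CARRIER

**Citation header (reproduction of PUBLISHED work; template of the Bałaban lattice Yang–Mills cell).**
J. Dimock, *The renormalization group according to Balaban II. Large fields*, J. Math. Phys. **54** (2013) 092301
(= arXiv:1212.5562v2) [Dimock2013BalabanII], §3.1.5 TeX L1849–1851 and L1864–1867, §3.5 L2721–2742, §3.10 L3659–3683.
TeX line numbers refer to the arXiv source held by the cell on this hub at
`run/shared/lean/archive/nearmiss/qft-balaban/dimock/src/1212.5562/1212.5562.tex` (7217 lines, sha256[:16]
75c5792fc48eacbc).  Dimock's papers are published and refereed and are the cell's TEMPLATE, not manuscripts under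
audit; no quantity of the Bałaban series is touched.

**What the paper prints (verbatim).**  L1849–1851: *"We also define □^{∼n} to be □ enlarged by n layers of M blocks,
and more generally X^{∼n} = ⋃_{□⊂X} □^{∼n} = X enlarged by n layers of M blocks"*; L1864–1867: *"X^* = X enlarged by
[r_k] layers of M blocks = X^{∼[r_k]} … X^{2*} = X^{**}, X^{3*} = X^{***}, etc."*; L2725–2727: *"Here the \*, ♮ operations
refer to adding or deleting layers of LM-cubes. In generating Ω^c_{k+1} from (Λ̄_k)^c we add at least 5[r_{k+1}] layers
of LM-cubes so d((Λ̄_k)^c, Ω_{k+1}) ≥ 5[r_{k+1}]LM."*; L3681–3683: *"… Since both these sets contain Λ^{4*}_{k+1} we have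
the result."*

**What is reproduced here (kernel-checked, zero `sorry`).**  The sibling `CharacteristicFunctionSplit` (v8.82) proves
the §3.5∕§3.10 partitions of unity and region geometry over an ABSTRACT integer cube distance `d` (hypotheses `d x x =
0`, symmetry, triangle inequality); the sibling `LargeFieldRegionVolume` (namespace `RegionVolume`, v8.17) has the cell's
periodic carrier: cubes `TPt d N′ = (ℤ/N′)^d`, sup-norm balls `tball x s = x + box s` and `enl s X = ⋃_{x∈X} tball x s`.
This leaf supplies the distance and the bridge:
* §1 private `neg_mem_box`, `proj_neg`; **`mem_tball_comm`** (balls are symmetric), **`mem_tball_period`** (every cube is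
  within `N′` layers of every other), **`tdist x y`** `:= Nat.find (∃ s, y ∈ tball x s)` (the layer distance),
  **`mem_tball_iff_tdist_le`** (`y ∈ x^{∼s} ↔ d(x,y) ≤ s`), **`tdist_self`**, **`tdist_comm`**, **`tdist_triangle`**
  (from `RegionVolume.mem_tball_add`), `tdist_le_period` — so the three hypotheses of `CharacteristicFunctionSplit`
  HOLD on the torus carrier;
* §2 **`enl_tdist_eq` : CharacteristicFunctionSplit.enl tdist n X = RegionVolume.enl n X** (the two `X^{n*}` agree),
  **`mem_shr_tdist_iff` : x ∈ shr tdist n X ↔ tball x n ⊆ X** (`X^{n♮}` concretely);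
* §3 the §3.5∕§3.10 geometry on the torus with no residual hypothesis: **`separation_newRegion`** (`x ∉ Λ̄_k`, `y ∈
  Ω_{k+1} = Λ̄^{5r♮} − P^{5r*}` ⟹ `5r < d(y,x)`), **`enl_newLambda_subset`** (`RegionVolume.enl (4r) Λ_{k+1} ⊆ Ω^{r♮} − Q`
  and `⊆ Ω − R`), **`one_eq_sum_Cq_torus`** ((snafu) on the torus);
* §4 a non-vacuity `example`;
* §5 (v1.1) ITERATED ENLARGEMENTS ARE ENLARGEMENTS (*"X^{2*} = X^{**}, X^{3*} = X^{***}, etc."*, L1866–1867): private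
  `exists_box_add` (a box vector of radius `s + s′` splits as one of radius `s` plus one of radius `s′` — clamping),
  **`exists_mem_tball_of_add`** (`z ∈ x^{∼(s+s′)} ⟹ ∃ y ∈ x^{∼s}, z ∈ y^{∼s′}`), **`enl_enl_eq` : enl s′ (enl s X) =
  enl (s + s′) X** (equality, improving `RegionVolume.enl_enl_subset`), **`enl_iterate` : (enl r)^[n] X = enl (n·r) X**
  (so `X^{5*}` IS the five-fold iterate of `X^*`), **`exists_tdist_le_of_le_add`** (the layer distance has midpoints:
  `d(x,z) ≤ s + s′ ⟹ ∃ y, d(x,y) ≤ s ∧ d(y,z) ≤ s′`), `cfsEnl_cfsEnl_eq` (the same for `CharacteristicFunctionSplit.enl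
  tdist`);
* §6 (v1.1) WALK REACH ON THE TORUS — the concrete block geometry for the sibling `WalkExitExtraction` (v1.1 §6):
  **`hexit_of_tdist`**: blocks `z` with centre cubes `c z`, `cubes z ⊆ (c z)^{∼b}`, start blocks with centres in `x^{∼a}`,
  junction range `ℓ` in the layer distance (`h_zK_{z′} = 0` once `d(c z, c z′) > ℓ`), and `U ⊇ x^{∼R}` with `a + ℓ(m − 1)
  + b ≤ R` ⟹ the exit hypothesis `hexit` at length `m` (*"let □^* be the same with [r_{k+1}] layers of LM cubes added …
  any path must start in □, exit □^*, and then return to □. Thus the minimum number of steps is approximately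
  2[r_{k+1}]"*, L2995–2996, L3484–3486), by `WalkExitExtraction.hexit_of_junction_range` with `ρ = tdist ∘ c`;
  (v1.2) **`hexit_two_sided_of_tdist`**: the same with BOTH localisers at the printed count `2m` (`m` out, `m` back), by
  `WalkExitExtraction.hexit_two_sided`.

**Readings (declared).**  One "layer" = one cube of the sup-norm metric on `(ℤ/N′)^d` (wrap-around included; tiny tori
allowed as in `RegionVolume`); `[r_{k+1}]` layers per unit as in `CharacteristicFunctionSplit`.  **NOT claimed**: anything
about the fields or characteristic functions as functions of the fields; the continuum∕scaled distances `d_M`, `d_Ω`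
(stingray); anything of B1–B16.  NOT summit progress; NOT a statement about any Bałaban paper; NOT continuum; NOT Clay.
Imports the three siblings named; no Summits import; sub-namespace `…Dimock2011to13.TorusCubeLayers`; modifies nothing.
Unit `b2b-balaban-template` gen 34 (journal CLAIM D2-LAYERS-TORUS); v1.1 gen 35 (journal CLAIM D2-LAYERS-ITERATE: §5–§6
added, import `WalkExitExtraction` added, §1–§4 declarations unchanged, locators L2725–2727∕L3681–3683 corrected per the
cross-read of journal l.9279); v1.2 gen 35 (journal CLAIM D2-LAYERS-RETURN: `hexit_two_sided_of_tdist` added, all else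
unchanged); cell records TEMPLATE.md §4.2 rows «D2 §3.1», «D2 §3.5», «D2 §3.6–3.7», «D2 §3.10», GAPS C-tmpl34-6,
C-tmpl35-2, C-tmpl35-10.
-/

open Finset
open Literature.MathematicalPhysics.QuantumFieldTheory.Balaban1983to89.B13ScaleTransfer (Pt)
open Literature.MathematicalPhysics.QuantumFieldTheory.Balaban1983to89.TreeLengthTorus (TPt proj natLift proj_natLift)

namespace Literature.MathematicalPhysics.QuantumFieldTheory.Dimock2011to13.TorusCubeLayers

open RegionVolume CharacteristicFunctionSplit

variable {d N' : ℕ}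

/-! ## §1 The layer distance between cubes of the torus `(ℤ/N′)^d` -/

/-- Box vectors are closed under negation. [folklore] -/
private theorem neg_mem_box {s : ℕ} {v : Pt d} (hv : v ∈ box d s) : -v ∈ box d s :=
  mem_box.2 fun i => by
    have h := mem_box.1 hv i
    simp only [Pi.neg_apply]
    constructor <;> linarith [h.1, h.2]

/-- `proj` commutes with negation. [folklore] -/
private theorem proj_neg (v : Pt d) : proj N' (-v) = -proj N' v := by
  funext i
  simp [proj, Int.cast_neg]

/-- Balls are symmetric: `y ∈ x^{∼s} ↔ x ∈ y^{∼s}` (the layers of M blocks form a symmetric neighbourhood system). [cite: Dimock2013BalabanII, §3.1.5 (arXiv:1212.5562v2 TeX L1849–1851)] -/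
theorem mem_tball_comm {x y : TPt d N'} {s : ℕ} : y ∈ tball x s ↔ x ∈ tball y s := by
  constructor
  · intro h
    obtain ⟨v, hv, rfl⟩ := mem_tball.1 h
    exact mem_tball.2 ⟨-v, neg_mem_box hv, by rw [proj_neg, add_neg_cancel_right]⟩
  · intro h
    obtain ⟨v, hv, rfl⟩ := mem_tball.1 h
    exact mem_tball.2 ⟨-v, neg_mem_box hv, by rw [proj_neg, add_neg_cancel_right]⟩

variable [NeZero N']

/-- Every cube is within `N′` layers of every other (the periodic carrier is finite). [cite: Dimock2013BalabanII, §3.1.5 (arXiv:1212.5562v2 TeX L1849–1851)] -/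
theorem mem_tball_period (x y : TPt d N') : y ∈ tball x N' := by
  refine mem_tball.2 ⟨natLift (y - x), mem_box.2 fun i => ⟨?_, ?_⟩, ?_⟩
  · have : (0 : ℤ) ≤ (((y - x) i).val : ℤ) := by positivity
    simp only [natLift]; linarith
  · simp only [natLift]
    exact_mod_cast ((y - x) i).val_le
  · rw [proj_natLift, add_sub_cancel]

/-- **The layer distance** `d(x,y)` = the least `s` with `y ∈ x^{∼s}` (sup-norm distance in cubes on the periodic
carrier): the integer cube distance over which `CharacteristicFunctionSplit`'s `X^{n*}`∕`X^{n♮}` are taken.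
[cite: Dimock2013BalabanII, §3.1.5 (arXiv:1212.5562v2 TeX L1849–1851); §3.5 L2725–2727] -/
noncomputable def tdist (x y : TPt d N') : ℕ := Nat.find (exists_mem_tball x y)
  where
  /-- some ball around `x` contains `y`. [folklore] -/
  exists_mem_tball (x y : TPt d N') : ∃ s : ℕ, y ∈ tball x s := ⟨N', mem_tball_period x y⟩

/-- `y ∈ x^{∼s} ↔ d(x,y) ≤ s`. [cite: Dimock2013BalabanII, §3.1.5 (arXiv:1212.5562v2 TeX L1849–1851)] -/
theorem mem_tball_iff_tdist_le {x y : TPt d N'} {s : ℕ} : y ∈ tball x s ↔ tdist x y ≤ s := by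
  unfold tdist
  exact ⟨fun h => Nat.find_le h, fun h => tball_mono h (Nat.find_spec (tdist.exists_mem_tball x y))⟩

/-- `d(x,x) = 0` for the layer distance. [cite: Dimock2013BalabanII, §3.1.5 (arXiv:1212.5562v2 TeX L1849–1851)] -/
theorem tdist_self (x : TPt d N') : tdist x x = 0 :=
  Nat.eq_zero_of_le_zero (mem_tball_iff_tdist_le.1 (self_mem_tball x 0))

/-- `d(x,y) = d(y,x)` for the layer distance. [cite: Dimock2013BalabanII, §3.1.5 (arXiv:1212.5562v2 TeX L1849–1851)] -/
theorem tdist_comm (x y : TPt d N') : tdist x y = tdist y x :=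
  le_antisymm (mem_tball_iff_tdist_le.1 (mem_tball_comm.1 (mem_tball_iff_tdist_le.2 le_rfl)))
    (mem_tball_iff_tdist_le.1 (mem_tball_comm.1 (mem_tball_iff_tdist_le.2 le_rfl)))

/-- `d(x,z) ≤ d(x,y) + d(y,z)` for the layer distance (sup-norm triangle inequality on the torus: `(x^{∼s})^{∼s′} ⊆
x^{∼(s+s′)}`). [cite: Dimock2013BalabanII, §3.1.5 (arXiv:1212.5562v2 TeX L1849–1851)] -/
theorem tdist_triangle (x y z : TPt d N') : tdist x z ≤ tdist x y + tdist y z :=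
  mem_tball_iff_tdist_le.1 (mem_tball_add (mem_tball_iff_tdist_le.2 le_rfl) (mem_tball_iff_tdist_le.2 le_rfl))

/-- `d(x,y) ≤ N′` for the layer distance. [cite: Dimock2013BalabanII, §3.1.5 (arXiv:1212.5562v2 TeX L1849–1851)] -/
theorem tdist_le_period (x y : TPt d N') : tdist x y ≤ N' :=
  mem_tball_iff_tdist_le.1 (mem_tball_period x y)

/-! ## §2 The bridge: `CharacteristicFunctionSplit.enl tdist` is the ball enlargement `RegionVolume.enl` -/

/-- **`X^{n*}` two ways**: the distance-`≤ n` enlargement of `CharacteristicFunctionSplit` for the layer distance is the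
union of sup-norm balls `RegionVolume.enl` (*"X^{∼n} = ⋃_{□⊂X} □^{∼n} = X enlarged by n layers of M blocks"*).
[cite: Dimock2013BalabanII, §3.1.5 (arXiv:1212.5562v2 TeX L1849–1851)] -/
theorem enl_tdist_eq (n : ℕ) (X : Finset (TPt d N')) :
    CharacteristicFunctionSplit.enl tdist n X = RegionVolume.enl n X := by
  ext y
  rw [RegionVolume.mem_enl]
  simp only [CharacteristicFunctionSplit.enl, mem_filter, mem_univ, true_and]
  constructor
  · rintro ⟨x, hx, hxy⟩
    exact ⟨x, hx, mem_tball_iff_tdist_le.2 ((tdist_comm x y).le.trans hxy)⟩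
  · rintro ⟨x, hx, hy⟩
    exact ⟨x, hx, (tdist_comm y x).le.trans (mem_tball_iff_tdist_le.1 hy)⟩

/-- **`X^{n♮}` concretely**: a cube is in `X^{n♮}` iff its whole ball `□^{∼n}` lies in `X`.
[cite: Dimock2013BalabanII, §3.5 (arXiv:1212.5562v2 TeX L2725–2727)] -/
theorem mem_shr_tdist_iff {n : ℕ} {X : Finset (TPt d N')} {x : TPt d N'} :
    x ∈ CharacteristicFunctionSplit.shr tdist n X ↔ tball x n ⊆ X := by
  simp only [CharacteristicFunctionSplit.shr, mem_filter, mem_univ, true_and]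
  constructor
  · intro h z hz
    exact h z (mem_tball_iff_tdist_le.1 hz)
  · intro h z hz
    exact h (mem_tball_iff_tdist_le.2 hz)

/-! ## §3 The §3.5∕§3.10 region geometry on the torus carrier -/

/-- **The `5[r_{k+1}]` separation on the torus**: with `Ω_{k+1} = (Λ̄_k)^{5r♮} − P^{5r*}_{k+1}` built from the layer
distance, a cube outside `Λ̄_k` and a cube of `Ω_{k+1}` are more than `5r` layers apart — *"d((Λ̄_k)^c, Ω_{k+1}) ≥
5[r_{k+1}]LM"*. [cite: Dimock2013BalabanII, §3.5 (arXiv:1212.5562v2 TeX L2721–2727)] -/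
theorem separation_newRegion {r : ℕ} {S P : Finset (TPt d N')} {x y : TPt d N'} (hx : x ∉ S)
    (hy : y ∈ newRegion tdist (5 * r) S P) : 5 * r < tdist y x :=
  lt_dist_of_mem_newRegion hx hy

/-- **`Λ^{4*}_{k+1} ⊆ Ω^♮_{k+1} − Q_{k+1}` and `⊆ Ω_{k+1} − R_{k+1}` on the torus**, with the enlargements as unions of
sup-norm balls (`RegionVolume.enl`). [cite: Dimock2013BalabanII, §3.10 (arXiv:1212.5562v2 TeX L3659–3683)] -/
theorem enl_newLambda_subset (r : ℕ) (Ω Q R' : Finset (TPt d N')) :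
    RegionVolume.enl (4 * r) (newLambda tdist r Ω Q R') ⊆ CharacteristicFunctionSplit.shr tdist r Ω \ Q ∧
      RegionVolume.enl (4 * r) (newLambda tdist r Ω Q R') ⊆ Ω \ R' := by
  rw [← enl_tdist_eq]
  exact ⟨enl_newLambda_subset_shr_sdiff tdist_triangle tdist_comm r Ω Q R',
    enl_newLambda_subset_sdiff tdist_triangle tdist_comm tdist_self r Ω Q R'⟩

/-- and (snafu)∕(breakup2) hold verbatim on the torus carrier, e.g. (snafu): [cite: Dimock2013BalabanII, §3.5 eq. (snafu) (arXiv:1212.5562v2 TeX L2732–2742)] -/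
theorem one_eq_sum_Cq_torus {R : Type*} [CommRing R] (n : ℕ) (χ : TPt d N' → R) (S : Finset (TPt d N')) :
    (1 : R) = ∑ Ω : Finset (TPt d N'), Cq tdist n χ S Ω * chi χ Ω :=
  one_eq_sum_Cq_mul_chi tdist_self n χ S

/-! ## §4 Non-vacuity -/

/-- The torus statements are unconditional; e.g. on `(ℤ/7)³` with one layer per unit. -/
example (Ω Q R' : Finset (TPt 3 7)) :
    RegionVolume.enl 4 (newLambda tdist 1 Ω Q R') ⊆ Ω \ R' := by
  simpa using (enl_newLambda_subset 1 Ω Q R').2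

/-! ## §5 (v1.1) Iterated enlargements are enlargements: `X^{n*}` is the `n`-fold iterate of `X^*` -/

omit [NeZero N'] in
/-- A box vector of radius `s + s′` is a box vector of radius `s` plus one of radius `s′` (clamp each coordinate to
`[−s, s]`). [folklore] -/
private theorem exists_box_add {s s' : ℕ} {v : Pt d} (hv : v ∈ box d (s + s')) :
    ∃ u ∈ box d s, ∃ w ∈ box d s', v = u + w := by
  set u : Pt d := fun i => max (-(s : ℤ)) (min (s : ℤ) (v i)) with hu
  refine ⟨u, mem_box.2 fun i => ?_, v - u, mem_box.2 fun i => ?_, by abel⟩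
  · simp only [hu, max_def, min_def]
    split_ifs <;> constructor <;> omega
  · have h := mem_box.1 hv i
    simp only [hu, Pi.sub_apply, Nat.cast_add, max_def, min_def] at h ⊢
    split_ifs <;> constructor <;> omega

omit [NeZero N'] in
/-- **`x^{∼(s+s′)} = (x^{∼s})^{∼s′}` pointwise**: a cube within `s + s′` layers of `x` is within `s′` layers of a cube
within `s` layers of `x`. [cite: Dimock2013BalabanII, §3.1.5 (arXiv:1212.5562v2 TeX L1849–1851, L1866–1867)] -/
theorem exists_mem_tball_of_add {x z : TPt d N'} {s s' : ℕ} (hz : z ∈ tball x (s + s')) :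
    ∃ y ∈ tball x s, z ∈ tball y s' := by
  obtain ⟨v, hv, rfl⟩ := mem_tball.1 hz
  obtain ⟨u, hu, w, hw, rfl⟩ := exists_box_add hv
  exact ⟨x + proj N' u, mem_tball.2 ⟨u, hu, rfl⟩, mem_tball.2 ⟨w, hw, by rw [proj_add, add_assoc]⟩⟩

omit [NeZero N'] in
/-- **`(X^{∼s})^{∼s′} = X^{∼(s+s′)}`** — EQUALITY on the torus carrier (the sibling's `RegionVolume.enl_enl_subset` is
the inclusion `⊆`): enlarging by `s` layers and then by `s′` layers is enlarging by `s + s′` layers. [cite: Dimock2013BalabanII, §3.1.5 (arXiv:1212.5562v2 TeX L1849–1851, L1866–1867)] -/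
theorem enl_enl_eq (s s' : ℕ) (X : Finset (TPt d N')) :
    RegionVolume.enl s' (RegionVolume.enl s X) = RegionVolume.enl (s + s') X := by
  refine Subset.antisymm (enl_enl_subset s s' X) fun z hz => ?_
  obtain ⟨x, hx, hzx⟩ := mem_enl.1 hz
  obtain ⟨y, hy, hzy⟩ := exists_mem_tball_of_add hzx
  exact mem_enl.2 ⟨y, mem_enl.2 ⟨x, hx, hy⟩, hzy⟩

omit [NeZero N'] in
/-- `X^{∼0} = X` (enlarging by zero layers of M blocks is the identity). [cite: Dimock2013BalabanII, §3.1.5 (arXiv:1212.5562v2 TeX L1849–1851)] -/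
theorem enl_zero (X : Finset (TPt d N')) : RegionVolume.enl 0 X = X := by
  refine Subset.antisymm (fun z hz => ?_) (subset_enl 0 X)
  obtain ⟨x, hx, hzx⟩ := mem_enl.1 hz
  rwa [eq_of_mem_tball_zero hzx]

omit [NeZero N'] in
/-- **`X^{n*} = X^{*⋯*}`** (*"X^{2*} = X^{**}, X^{3*} = X^{***}, etc."*): the `n`-fold iterate of the enlargement by `r`
layers IS the enlargement by `n·r` layers — so `X^{5*} = X^{∼5[r_k]}` literally. [cite: Dimock2013BalabanII, §3.1.5 (arXiv:1212.5562v2 TeX L1864–1867)] -/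
theorem enl_iterate (r n : ℕ) (X : Finset (TPt d N')) :
    (RegionVolume.enl r)^[n] X = RegionVolume.enl (n * r) X := by
  induction n with
  | zero => rw [Function.iterate_zero, id, zero_mul, enl_zero]
  | succ n ih => rw [Function.iterate_succ_apply', ih, enl_enl_eq, Nat.succ_mul]

/-- **The layer distance has midpoints**: `d(x,z) ≤ s + s′ ⟹ ∃ y, d(x,y) ≤ s ∧ d(y,z) ≤ s′` (so `tdist` is a geodesic
integer metric and the abstract `X^{n*}` of `CharacteristicFunctionSplit` iterates exactly). [cite: Dimock2013BalabanII, §3.1.5 (arXiv:1212.5562v2 TeX L1849–1851, L1866–1867)] -/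
theorem exists_tdist_le_of_le_add {x z : TPt d N'} {s s' : ℕ} (h : tdist x z ≤ s + s') :
    ∃ y, tdist x y ≤ s ∧ tdist y z ≤ s' := by
  obtain ⟨y, hy, hzy⟩ := exists_mem_tball_of_add (mem_tball_iff_tdist_le.2 h)
  exact ⟨y, mem_tball_iff_tdist_le.1 hy, mem_tball_iff_tdist_le.1 hzy⟩

/-- the same iterate equality for `CharacteristicFunctionSplit.enl tdist`. [cite: Dimock2013BalabanII, §3.1.5 (arXiv:1212.5562v2 TeX L1864–1867)] -/
theorem cfsEnl_cfsEnl_eq (s s' : ℕ) (X : Finset (TPt d N')) :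
    CharacteristicFunctionSplit.enl tdist s' (CharacteristicFunctionSplit.enl tdist s X)
      = CharacteristicFunctionSplit.enl tdist (s + s') X := by
  rw [enl_tdist_eq, enl_tdist_eq, enl_tdist_eq, enl_enl_eq]

/-! ## §6 (v1.1) Walk reach on the torus: fewer than `m` overlapping steps cannot leave `□^*` -/

section WalkReach

open RandomWalkExpansion (Kz walkTerm)
open DecouplingWeights (Xω)
open WalkExitExtraction (hexit_of_junction_range)

/-- **THE EXIT HYPOTHESIS ON THE TORUS CARRIER** — *"let □^* be the same with [r_{k+1}] layers of LM cubes added … any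
path must start in □, exit □^*, and then return to □. Thus the minimum number of steps is approximately 2[r_{k+1}]"*: for
blocks `z` with centre cubes `c z` and cubes `cubes z ⊆ (c z)^{∼b}`, start blocks `S₀` with centres in `x^{∼a}`, the
junction range `ℓ` in the layer distance (`h_zK_{z′} = 0` once `d(c z, c z′) > ℓ` — *"h_z h_{z′} = 0 unless z, z′ are
neighbors"*), and `U ⊇ x^{∼R}` with `a + ℓ(m − 1) + b ≤ R`: every walk of fewer than `m` steps from `S₀` whose cubes
leave `U` has `G_{k,ω} = 0` (the hypothesis `hexit` of `WalkExitExtraction.norm_mul_Gs_sub_Gs_le`, by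
`WalkExitExtraction.hexit_of_junction_range` with `ρ = d ∘ c` and `tdist_triangle`). [cite: Dimock2013BalabanII, §3.7 (arXiv:1212.5562v2 TeX L2995–2996); Lemma stem proof L3484–3486; Lemma r6 proof L3588–3590; Dimock2013, §2.4 (arXiv:1108.1335v2 TeX L932–938, L972)] -/
theorem hexit_of_tdist {Z : Type*} {R : Type*} [Ring R] {A : R} {H G : Z → R} (c : Z → TPt d N')
    {cubes : Z → Finset (TPt d N')} {S₀ : Finset Z} {U : Finset (TPt d N')} {x : TPt d N'} {a b ℓ m R' : ℕ}
    (hcubes : ∀ z, cubes z ⊆ tball (c z) b) (hS₀ : ∀ z ∈ S₀, c z ∈ tball x a)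
    (hjunc : ∀ z z', ℓ < tdist (c z) (c z') → H z * Kz A H z' = 0) (hR : a + ℓ * (m - 1) + b ≤ R')
    (hU : tball x R' ⊆ U) :
    ∀ n, n < m → ∀ z₀ ∈ S₀, ∀ ω : Fin n → Z, ¬ Xω cubes ω ⊆ U → walkTerm A H G z₀ ω = 0 :=
  hexit_of_junction_range (ρ := fun z z' => tdist (c z) (c z')) (fun _ _ _ => tdist_triangle _ _ _) hjunc
    fun z₀ hz₀ z hz => (hcubes z).trans fun _ hy =>
      hU (tball_mono hR (mem_tball_add (mem_tball_add (hS₀ z₀ hz₀) (mem_tball_iff_tdist_le.2 hz)) hy))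

/-- Non-vacuity on `(ℤ/9)²`: blocks = cubes (`c = id`, `cubes z = z^{∼1}`), one start block `x`, range `ℓ = 2`,
`m = 3` forced steps, `U = x^{∼7}` (`0 + 2·2 + 1 ≤ 7`), for any operators. -/
example {R : Type*} [Ring R] (A : R) (H G : TPt 2 9 → R) (x : TPt 2 9)
    (hjunc : ∀ z z', 2 < tdist z z' → H z * Kz A H z' = 0) :
    ∀ n, n < 3 → ∀ z₀ ∈ ({x} : Finset (TPt 2 9)), ∀ ω : Fin n → TPt 2 9,
      ¬ Xω (fun z => tball z 1) ω ⊆ tball x 7 → walkTerm A H G z₀ ω = 0 :=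
  hexit_of_tdist id (b := 1) (a := 0) (fun _ => Subset.refl _)
    (fun z hz => by rw [Finset.mem_singleton.1 hz]; exact self_mem_tball x 0) hjunc (by norm_num) (Subset.refl _)

/-- **EXIT AND RETURN ON THE TORUS CARRIER — the printed count `2[r_{k+1}]`**: with both localisers (start blocks `S₀`
with centres in `x^{∼a}`, END blocks `S₀′` with centres in `x′^{∼a}`, `U ⊇ x^{∼R′} ∪ x′^{∼R′}`, `a + ℓ(m − 1) + b ≤ R′`), a
walk of fewer than `2m` steps from `S₀` ending in `S₀′` whose cubes leave `U` has `G_{k,ω} = 0` — *"any path must start in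
□, exit □^*, and then return to □. Thus the minimum number of steps is approximately 2[r_{k+1}]"* (print: `x = x′ = □`,
`S₀`, `S₀′` = blocks meeting `Δ_y`, `Δ_{y′}`, `y, y′ ∈ □`), by `WalkExitExtraction.hexit_two_sided` (v1.2) with `ρ = d ∘ c`
(`tdist_self`, `tdist_comm`, `tdist_triangle`). [cite: Dimock2013BalabanII, Lemma stem proof (arXiv:1212.5562v2 TeX L3484–3486); Lemma r6 proof L3588–3590; Dimock2013, §2.4 (arXiv:1108.1335v2 TeX L932–938, L972)] -/
theorem hexit_two_sided_of_tdist {Z : Type*} {R : Type*} [Ring R] {A : R} {H G : Z → R} (c : Z → TPt d N')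
    {cubes : Z → Finset (TPt d N')} {S₀ S₀' : Finset Z} {U : Finset (TPt d N')} {x x' : TPt d N'}
    {a b ℓ m R' : ℕ} (hcubes : ∀ z, cubes z ⊆ tball (c z) b) (hS₀ : ∀ z ∈ S₀, c z ∈ tball x a)
    (hS₀' : ∀ z ∈ S₀', c z ∈ tball x' a) (hjunc : ∀ z z', ℓ < tdist (c z) (c z') → H z * Kz A H z' = 0)
    (hR : a + ℓ * (m - 1) + b ≤ R') (hU : tball x R' ⊆ U) (hU' : tball x' R' ⊆ U) :
    ∀ n, n < 2 * m → ∀ z₀ ∈ S₀, ∀ ω : Fin n → Z, WalkExitExtraction.lastBlock z₀ ω ∈ S₀' →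
      ¬ Xω cubes ω ⊆ U → walkTerm A H G z₀ ω = 0 :=
  WalkExitExtraction.hexit_two_sided (ρ := fun z z' => tdist (c z) (c z')) (fun _ => tdist_self _)
    (fun _ _ => tdist_comm _ _) (fun _ _ _ => tdist_triangle _ _ _) hjunc
    (fun z₀ hz₀ z hz => (hcubes z).trans fun _ hy =>
      hU (tball_mono hR (mem_tball_add (mem_tball_add (hS₀ z₀ hz₀) (mem_tball_iff_tdist_le.2 hz)) hy)))
    (fun z₁ hz₁ z hz => (hcubes z).trans fun _ hy =>
      hU' (tball_mono hR (mem_tball_add (mem_tball_add (hS₀' z₁ hz₁) (mem_tball_iff_tdist_le.2 hz)) hy)))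

end WalkReach

end Literature.MathematicalPhysics.QuantumFieldTheory.Dimock2011to13.TorusCubeLayers
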